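import Mathlib
import HarnessLib
import Literature.Probability.MarkovChains.SpectralMixingTimeBound

/-!
# Transitive chains: the uniform law is stationary (Prop. 2.16) and the `ℓ²` bound `4d(t)² ≤ Σ_{j≥2} λ_j^{2t}` (Lemma 12.18 (ii))

HONEST FRAMING: exact (Metropolis-corrected) sampling algorithms for lattice gauge theory; figures
of merit are autocorrelation/cost numbers at stated couplings and volumes; no continuum-physics claim.

Conventions of `MixingTimeSubmultiplicative.lean` (`kernelAt P t x y = Pᵗ(x,y)`), `BottleneckRatio.lean`
(`worstTvDist P π t = d(t)`), `PeskunOrdering.lean` (`piInner`), `SpectralRepresentation.lean` (the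
`π`-orthonormal eigenfunctions `specFun hA j = f_j`, eigenvalues `specVal hA j = λ_j` of a reversible
`P`) and `SpectralMixingTimeBound.lean` (Lemma 12.18 (i)).  Source: D. A. Levin, Y. Peres (with
E. L. Wilmer), *Markov Chains and Mixing Times*, 2nd ed., AMS 2017 [LevinPeres2017], §2.6.2
"Transitive chains" (eq. (2.15), Prop. 2.16, p. 29) and §12.6 Lemma 12.18 (ii) (pp. 172–173).
Everything is PROVED (finite sums; 0 named facts).

* `IsTransitive P` — **eq. (2.15)**: for each pair `(x,y)` there is a bijection `φ` of `X` with
  `φ(x) = y` and `P(z,w) = P(φ(z),φ(w))` for all `z,w` [cite: LevinPeres2017, §2.6.2 eq. (2.15)];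
* **PROPOSITION 2.16** `LevinPeres2017_prop_2_16`: the uniform distribution is stationary for a
  transitive transition matrix [cite: LevinPeres2017, §2.6.2 Prop. 2.16];
* `kernelAt_equiv` — a `P`-preserving bijection preserves `Pᵗ`: `Pᵗ(φz,φw) = Pᵗ(z,w)`;
  `piInner_kernelAt_div_sub_one_eq` — hence `‖Pᵗ(x,·)/π − 1‖²₂` does not depend on `x` for the
  uniform `π` ("the left-hand side of (12.26) does not depend on `x`");
* **LEMMA 12.18 (ii)** `LevinPeres2017_lemma_12_18_ii_eq` — for a transitive, irreducible `P`
  reversible with respect to the uniform `π` (`|X| ≥ 2`): **`‖Pᵗ(x₀,·)/π − 1‖²₂ = Σ_{j : λ_j ≠ 1} λ_j^{2t}`**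
  (eq. (12.27) averaged over `x`: `Σ_x f_j(x)²π(x) = 1`), and `LevinPeres2017_lemma_12_18_ii`:
  **`4 d(t)² ≤ Σ_{j : λ_j ≠ 1} λ_j^{2t}`** [cite: LevinPeres2017, §12.6 Lemma 12.18 (ii),
  eqs. (12.27)–(12.28)].  (The book's `Σ_{j=2}^{|X|}` over an eigenvalue ordering is the sum over the
  `λ_j ≠ 1` block of the tree's `X`-indexed eigenbasis, as in Lemma 12.18 (i) of
  `SpectralMixingTimeBound.lean`; for an irreducible chain the two agree.)

Context (cell pub-lqcd, venture LatticeQCDFlow): translation-invariant local dynamics on a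
periodic lattice (and random walks on groups, e.g. on `ℤ_n` or on a gauge group) are transitive;
(12.28) is the standard `ℓ²` route from the spectrum to `d(t)` for such samplers, with no `π_min`
loss compared with Theorem 12.4.
-/

namespace Literature.Probability.MarkovChains

open Finset Matrix

variable {X : Type*} [Fintype X] [DecidableEq X]

/-- **Eq. (2.15)**: a transition matrix is TRANSITIVE if for each pair `(x,y)` there is a bijection
`φ = φ_{(x,y)}` of `X` with `φ(x) = y` and `P(z,w) = P(φ(z),φ(w))` for all `z, w` ("the chain looks
the same from any point"). [cite: LevinPeres2017, §2.6.2 eq. (2.15)] -/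
def IsTransitive (P : X → X → ℝ) : Prop :=
  ∀ x y : X, ∃ φ : X ≃ X, φ x = y ∧ ∀ z w, P z w = P (φ z) (φ w)

section Stationary

variable {P : X → X → ℝ}

omit [DecidableEq X] in
/-- For a transitive `P`, all column sums agree: `Σ_z P(z,x) = Σ_w P(w,y)` (substitute `z = φ(w)`).
[cite: LevinPeres2017, §2.6.2 Prop. 2.16 (proof, first display)] -/
theorem colSum_eq_of_isTransitive (hT : IsTransitive P) (x y : X) :
    ∑ z, P z x = ∑ w, P w y := by
  obtain ⟨φ, hφx, hφ⟩ := hT x y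
  calc ∑ z, P z x = ∑ v, P (φ v) (φ x) := sum_congr rfl fun v _ => hφ v x
    _ = ∑ v, P (φ v) y := by rw [hφx]
    _ = ∑ w, P w y := Equiv.sum_comp φ (fun w => P w y)

omit [DecidableEq X] in
/-- **PROPOSITION 2.16**: the uniform probability distribution is stationary for a transitive
transition matrix ("summing over `w` shows … `U = UP`"). [cite: LevinPeres2017, §2.6.2 Prop. 2.16] -/
theorem LevinPeres2017_prop_2_16 (hT : IsTransitive P) (hP : IsRowStochastic P) {π : X → ℝ}
    (hπu : ∀ x, π x = (Fintype.card X : ℝ)⁻¹) : IsStationary π P := by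
  intro y
  simp_rw [hπu]
  rw [← mul_sum]
  -- all column sums equal `c`; their total is `Σ_z Σ_x P(z,x) = |X|`, so `c = 1`
  have hcol : ∀ x, ∑ z, P z x = ∑ z, P z y := fun x => colSum_eq_of_isTransitive hT x y
  have htot : ∑ x, ∑ z, P z x = Fintype.card X := by
    rw [sum_comm]
    simp_rw [hP.2]
    simp
  simp_rw [hcol] at htot
  rw [sum_const, card_univ, nsmul_eq_mul] at htot
  have hn : (Fintype.card X : ℝ) ≠ 0 := by
    have : 0 < Fintype.card X := Fintype.card_pos_iff.mpr ⟨y⟩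
    exact_mod_cast this.ne'
  have hc : ∑ z, P z y = 1 := by
    have h := htot
    field_simp at h
    linarith [h]
  rw [hc, mul_one]

end Stationary

/-! ## `Pᵗ` and `‖Pᵗ(x,·)/π − 1‖₂` are invariant under `P`-preserving bijections -/

section Invariance

variable {P : X → X → ℝ}

/-- `P⁰(x,y) = 1{y = x}`. [cite: LevinPeres2017, §1.1 (`P⁰ = I`)] -/
private theorem kernelAt_zero_apply'' (P : X → X → ℝ) (x y : X) :
    kernelAt P 0 x y = if y = x then 1 else 0 := by
  show lawAt P (Pi.single x 1) 0 y = _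
  rw [lawAt_zero, Pi.single_apply]

/-- `P^{t+1}(x,y) = Σ_z Pᵗ(x,z) P(z,y)`. [cite: LevinPeres2017, §1.1 (`μ_t = μ_{t−1}P`)] -/
private theorem kernelAt_succ_apply'' (P : X → X → ℝ) (t : ℕ) (x y : X) :
    kernelAt P (t + 1) x y = ∑ z, kernelAt P t x z * P z y := by
  show lawAt P (Pi.single x 1) (t + 1) y = _
  rw [lawAt_succ]
  rfl

/-- A `P`-preserving bijection preserves the `t`-step kernel: `Pᵗ(φz,φw) = Pᵗ(z,w)`.
[cite: LevinPeres2017, §2.6.2 eq. (2.15) (with §12.6 Lemma 12.18 (ii): "the left-hand side of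
(12.26) does not depend on `x`")] -/
theorem kernelAt_equiv (φ : X ≃ X) (hφ : ∀ z w, P z w = P (φ z) (φ w)) :
    ∀ (t : ℕ) (z w : X), kernelAt P t (φ z) (φ w) = kernelAt P t z w := by
  intro t
  induction t with
  | zero =>
    intro z w
    rw [kernelAt_zero_apply'', kernelAt_zero_apply'']
    simp only [EmbeddingLike.apply_eq_iff_eq]
  | succ t ih =>
    intro z w
    rw [kernelAt_succ_apply'', kernelAt_succ_apply'']
    calc ∑ u, kernelAt P t (φ z) u * P u (φ w)
        = ∑ v, kernelAt P t (φ z) (φ v) * P (φ v) (φ w) :=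
          (Equiv.sum_comp φ (fun u => kernelAt P t (φ z) u * P u (φ w))).symm
      _ = ∑ v, kernelAt P t z v * P v w := sum_congr rfl fun v _ => by rw [ih z v, ← hφ v w]

omit [DecidableEq X] in
/-- For the uniform `π`, `‖Pᵗ(φx,·)/π − 1‖²₂ = ‖Pᵗ(x,·)/π − 1‖²₂` for a `P`-preserving bijection `φ`.
[cite: LevinPeres2017, §12.6 Lemma 12.18 (ii) (proof: "the left-hand side of (12.26) does not
depend on `x`")] -/
theorem piInner_kernelAt_div_sub_one_equiv [DecidableEq X] {π : X → ℝ}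
    (hπu : ∀ x, π x = (Fintype.card X : ℝ)⁻¹) (φ : X ≃ X) (hφ : ∀ z w, P z w = P (φ z) (φ w))
    (t : ℕ) (x : X) :
    piInner π (fun y => kernelAt P t (φ x) y / π y - 1) (fun y => kernelAt P t (φ x) y / π y - 1)
      = piInner π (fun y => kernelAt P t x y / π y - 1) (fun y => kernelAt P t x y / π y - 1) := by
  unfold piInner
  simp_rw [hπu]
  calc ∑ y, (Fintype.card X : ℝ)⁻¹ *
          ((kernelAt P t (φ x) y / (Fintype.card X : ℝ)⁻¹ - 1) *
            (kernelAt P t (φ x) y / (Fintype.card X : ℝ)⁻¹ - 1))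
      = ∑ w, (Fintype.card X : ℝ)⁻¹ *
          ((kernelAt P t (φ x) (φ w) / (Fintype.card X : ℝ)⁻¹ - 1) *
            (kernelAt P t (φ x) (φ w) / (Fintype.card X : ℝ)⁻¹ - 1)) :=
        (Equiv.sum_comp φ _).symm
    _ = _ := sum_congr rfl fun w _ => by rw [kernelAt_equiv φ hφ t x w]

/-- **For a transitive chain `‖Pᵗ(x,·)/π − 1‖²₂` (uniform `π`) does not depend on `x`.**
[cite: LevinPeres2017, §12.6 Lemma 12.18 (ii) (proof, first sentence)] -/
theorem piInner_kernelAt_div_sub_one_eq (hT : IsTransitive P) {π : X → ℝ}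
    (hπu : ∀ x, π x = (Fintype.card X : ℝ)⁻¹) (t : ℕ) (x y : X) :
    piInner π (fun w => kernelAt P t x w / π w - 1) (fun w => kernelAt P t x w / π w - 1)
      = piInner π (fun w => kernelAt P t y w / π w - 1) (fun w => kernelAt P t y w / π w - 1) := by
  obtain ⟨φ, hφx, hφ⟩ := hT x y
  rw [← hφx]
  exact (piInner_kernelAt_div_sub_one_equiv hπu φ hφ t x).symm

end Invariance

/-! ## LEMMA 12.18 (ii) -/

section L2

variable {P : Matrix X X ℝ} {π : X → ℝ}

/-- **LEMMA 12.18 (ii), eq. (12.27) averaged**: for a transitive, irreducible `P`, reversible with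
respect to the uniform `π`, and every `x₀`,
**`‖Pᵗ(x₀,·)/π − 1‖²₂ = Σ_{j : λ_j ≠ 1} λ_j^{2t}`** — "Averaging over `x` yields … Since
`Σ_x f_j(x)²π(x) = 1`". [cite: LevinPeres2017, §12.6 Lemma 12.18 (ii), eq. (12.27)] -/
theorem LevinPeres2017_lemma_12_18_ii_eq (hT : IsTransitive P)
    (hπu : ∀ x, π x = (Fintype.card X : ℝ)⁻¹) (hπ : ∀ x, 0 < π x) (hπ1 : ∑ x, π x = 1)
    (hP : IsRowStochastic P) (hDB : DetailedBalance π P) (hirr : IsIrreducible P)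
    (hA : (symmMatrix π P).IsHermitian) (t : ℕ) (x₀ : X) :
    piInner π (fun y => kernelAt P t x₀ y / π y - 1) (fun y => kernelAt P t x₀ y / π y - 1)
      = ∑ j ∈ univ.filter (fun j => specVal hA j ≠ 1), specVal hA j ^ (2 * t) := by
  set J := univ.filter (fun j => specVal hA j ≠ 1) with hJ
  set S : X → ℝ := fun x =>
    piInner π (fun y => kernelAt P t x y / π y - 1) (fun y => kernelAt P t x y / π y - 1) with hS
  -- `S(x) = Σ_J f_j(x)² λ_j^{2t}` (Lemma 12.18 (i)) and `S` is constant (transitivity)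
  have hSx : ∀ x, S x = ∑ j ∈ J, specFun hA j x ^ 2 * specVal hA j ^ (2 * t) :=
    fun x => LevinPeres2017_lemma_12_18_i_eq hπ hπ1 hP hDB hirr hA t x
  have hconst : ∀ x, S x = S x₀ := fun x => piInner_kernelAt_div_sub_one_eq hT hπu t x x₀
  -- average over `π`: `S(x₀) = Σ_x π(x) S(x) = Σ_J λ_j^{2t} Σ_x π(x) f_j(x)² = Σ_J λ_j^{2t}`
  have havg : S x₀ = ∑ x, π x * S x := by
    simp_rw [hconst]
    rw [← sum_mul, hπ1, one_mul]
  change S x₀ = _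
  rw [havg]
  simp_rw [hSx, mul_sum]
  rw [sum_comm]
  refine sum_congr rfl fun j _ => ?_
  have hnorm : ∑ x, π x * (specFun hA j x * specFun hA j x) = 1 := by
    have h := piInner_specFun hπ hA j j
    rw [if_pos rfl] at h
    exact h
  calc ∑ x, π x * (specFun hA j x ^ 2 * specVal hA j ^ (2 * t))
      = (∑ x, π x * (specFun hA j x * specFun hA j x)) * specVal hA j ^ (2 * t) := by
        rw [sum_mul]
        exact sum_congr rfl fun x _ => by ring
    _ = specVal hA j ^ (2 * t) := by rw [hnorm, one_mul]

/-- **LEMMA 12.18 (ii)**: if the chain is transitive (irreducible, reversible with respect to the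
uniform `π`, `|X| ≥ 1`), then **`4‖Pᵗ(x,·) − π‖²_TV ≤ Σ_{j : λ_j ≠ 1} λ_j^{2t}`** for every `x`, hence
**`4 d(t)² ≤ Σ_{j : λ_j ≠ 1} λ_j^{2t}`** — eq. (12.28). [cite: LevinPeres2017, §12.6 Lemma 12.18 (ii),
eq. (12.28)] -/
theorem LevinPeres2017_lemma_12_18_ii (hT : IsTransitive P)
    (hπu : ∀ x, π x = (Fintype.card X : ℝ)⁻¹) (hπ : ∀ x, 0 < π x) (hπ1 : ∑ x, π x = 1)
    (hP : IsRowStochastic P) (hDB : DetailedBalance π P) (hirr : IsIrreducible P)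
    (hA : (symmMatrix π P).IsHermitian) (t : ℕ) :
    4 * worstTvDist P π t ^ 2 ≤ ∑ j ∈ univ.filter (fun j => specVal hA j ≠ 1), specVal hA j ^ (2 * t) := by
  haveI : Nonempty X := by
    by_contra h
    rw [not_nonempty_iff] at h
    rw [univ_eq_empty, sum_empty] at hπ1
    exact zero_ne_one hπ1
  obtain ⟨x, hx⟩ := exists_tvDist_single_eq_worstTvDist P π t
  rw [← hx, ← LevinPeres2017_lemma_12_18_ii_eq hT hπu hπ hπ1 hP hDB hirr hA t x]
  exact four_mul_tvDist_sq_le_piInner hπ hπ1 _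

end L2

end Literature.Probability.MarkovChains
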